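import Summits.Ventures.PercRepro.RankLevelSetRuleQSliceFirstUntrunc
import Summits.Ventures.PercRepro.RankLevelSetRuleQRhat

/-!
# PercRepro — THE FIRST UNTRUNCATED SLICE AT THE MATROID LEVEL (night-1, gen 21; dossier §32.2)

`first_untrunc_slice` transferred to every finite matroid through `rhat_le_ruleQRecv`:
* **`ruleQRecv_ge_phiK_first_untrunc`** — at the tight layer `#E = (q+k) + q`, every member `Z` of the cell `(q+k, q)` with
  `#(flatPart M Z) = q − (k−1)` (the slice `u = k − 1`) receives at least `Φ(q+k, q)` under Rule Q's equal split, for every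
  `k ≥ 1` and every `k + 2 ≤ q ≤ k² − 1`;
* **`ruleQRecv_ge_phiK_first_untrunc_all`** — the same for every `k − 1 ≤ q ≤ k² − 1` with `q ≠ k + 1` (`k ≥ 2`).
Axioms: standard.
-/

namespace PercRepro

open Set Matroid Finset

variable {β : Type} (M : Matroid β) [M.Finite]

/-- **The slice `u = k − 1` at the matroid level, `k + 2 ≤ q ≤ k² − 1`**: every member with `#(flatPart M Z) = q − (k−1)` is paid. -/
theorem ruleQRecv_ge_phiK_first_untrunc {q k : ℕ} (hk : 1 ≤ k) (hq : k + 2 ≤ q) (hq' : q + 1 ≤ k * k)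
    (hE : M.E.ncard = (q + k) + q) {Z : Set β} (hZ : Z ∈ cellMembers M (q + k) q)
    (hP : (flatPart M Z).ncard = q - (k - 1)) :
    phiK (q + k) q ≤ ruleQRecv M (q + k) q Z := by
  have h1 := first_untrunc_slice k q hk hq hq'
  have h2 := rhat_le_ruleQRecv M hE hZ
  rw [hP] at h2
  exact h1.trans h2

/-- **The slice `u = k − 1` at the matroid level on every cell `k − 1 ≤ q ≤ k² − 1` except possibly `q = k + 1`** (`k ≥ 2`). -/
theorem ruleQRecv_ge_phiK_first_untrunc_all {q k : ℕ} (hk : 2 ≤ k) (hq : k - 1 ≤ q) (hq' : q + 1 ≤ k * k) (hne : q ≠ k + 1)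
    (hE : M.E.ncard = (q + k) + q) {Z : Set β} (hZ : Z ∈ cellMembers M (q + k) q)
    (hP : (flatPart M Z).ncard = q - (k - 1)) :
    phiK (q + k) q ≤ ruleQRecv M (q + k) q Z := by
  have h1 := first_untrunc_slice_all k q hk hq hq' hne
  have h2 := rhat_le_ruleQRecv M hE hZ
  rw [hP] at h2
  exact h1.trans h2

end PercRepro
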